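import Mathlib
import Summits.ResolutionOfSingularities.ResolutionOfSingularities.Theorems.WildQuotientsWildQuotientResolutionPthConeDefs

/-!
# The irrelevant ideal of the `μ_p` cone `(1/p)(w)` and a radical criterion
(crux stmt-ResolutionOfSingularities-15640 `WildQuotients.WildQuotientResolution`, line `Sketch`;
chain w45c POST-V5 S2 = the conductor-𝟙 core `ConductorOneCore p n` of bricks, brick F6
`…ConductorOneToricFan` of res-L1-w45c-lead-1's `S2-DESIGN.md` §3/§7 (7.6) and res-L1-w45c-plan-1's
RULING 2026-08-27T17:31:45Z (2): «NAME IT ONCE: `PthCone.irrelevant k n p w : Ideal ↥(PthCone.cone k n p w)`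
:= the kernel of the augmentation `cone → k` (constant coefficient), hence maximal and radical by
construction»; the toric brick `HT` of the scaffold `ConductorOne.conductorOneCore_hasResolution_of_bricks`
reads `∃ J₀, J₀.radical = PthCone.irrelevant … ∧ Scheme.IsRegular (affineBlowup J₀)`.
[OURS · L1 W4.5c] — NOT a statement of any manuscript; replaces the role of no printed item.
Owner res-L1-w45c-stub-4 (gen 5).)

* `PthCone.augmentation k n p w : cone →ₐ[k] k` — the constant coefficient;
* `PthCone.irrelevant k n p w : Ideal (cone k n p w)` — its kernel; `mem_irrelevant_iff`,
  `irrelevant_isMaximal`, `radical_irrelevant`, `monomialElem_mem_irrelevant`;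
* `PthCone.radical_eq_irrelevant_of_pow_mem` — **radical criterion**: an ideal `J ≤ irrelevant`
  containing, for every variable `x_l`, some power `x_l^e` with `p ∣ e`, has radical `= irrelevant`;
* `PthCone.vertexIdeal_radical` — the `b = 0` instance: with all weights `= 1` the Veronese vertex ideal
  has radical the irrelevant ideal (addendum to `PthCone.blowup_regular_veronese`).
No notation, no instances (plan-1 §6 (30)).
-/

set_option linter.dupNamespace false

noncomputable section

open MvPolynomial

namespace Summit.ResolutionOfSingularities.ResolutionOfSingularities.Theorems.WildQuotientResolution.PthCone

variable (k : Type) [Field k] (n p : ℕ) (w : Fin n → ZMod p)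

/-- **The augmentation** `cone → k`: the constant coefficient (evaluation at the vertex `x = 0`).
[OURS · L1 W4.5c] -/
def augmentation : cone k n p w →ₐ[k] k :=
  (MvPolynomial.aeval fun _ : Fin n => (0 : k)).comp (cone k n p w).val

/-- The augmentation is the constant coefficient. [OURS · L1 W4.5c] -/
theorem augmentation_apply (f : cone k n p w) :
    augmentation k n p w f = constantCoeff (f : MvPolynomial (Fin n) k) := by
  simp [augmentation]

/-- The augmentation is surjective (it is the identity on constants). [OURS · L1 W4.5c] -/
theorem augmentation_surjective : Function.Surjective (augmentation k n p w) := fun r =>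
  ⟨algebraMap k (cone k n p w) r, by
    rw [augmentation_apply, Subalgebra.coe_algebraMap, MvPolynomial.algebraMap_eq, constantCoeff_C]⟩

/-- **The irrelevant ideal** of the cone `(1/p)(w)`: the kernel of the augmentation, i.e. the elements with
constant coefficient `0` (the ideal of the vertex; spanned by the non-constant monomials of the cone).
[OURS · L1 W4.5c] -/
def irrelevant : Ideal (cone k n p w) :=
  RingHom.ker (augmentation k n p w)

/-- Membership in the irrelevant ideal is vanishing of the constant coefficient. [OURS · L1 W4.5c] -/
theorem mem_irrelevant_iff (f : cone k n p w) :
    f ∈ irrelevant k n p w ↔ constantCoeff (f : MvPolynomial (Fin n) k) = 0 := by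
  rw [irrelevant, RingHom.mem_ker, augmentation_apply]

/-- The irrelevant ideal is maximal. [OURS · L1 W4.5c] -/
theorem irrelevant_isMaximal : (irrelevant k n p w).IsMaximal :=
  RingHom.ker_isMaximal_of_surjective (augmentation k n p w) (augmentation_surjective k n p w)

/-- The irrelevant ideal is radical. [OURS · L1 W4.5c] -/
theorem radical_irrelevant : (irrelevant k n p w).radical = irrelevant k n p w :=
  (irrelevant_isMaximal k n p w).isPrime.radical

/-- The monomial `x^d` (weight `0`) as an element of the cone. [OURS · L1 W4.5c] -/
def monomialElem (d : Fin n →₀ ℕ) (hd : Finsupp.weight w d = 0) : cone k n p w :=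
  ⟨monomial d 1, monomial_mem_cone k n p w hd 1⟩

/-- The value of `monomialElem`. [OURS · L1 W4.5c] -/
@[simp] theorem coe_monomialElem (d : Fin n →₀ ℕ) (hd : Finsupp.weight w d = 0) :
    ((monomialElem k n p w d hd : cone k n p w) : MvPolynomial (Fin n) k) = monomial d 1 :=
  rfl

/-- A non-constant monomial of the cone lies in the irrelevant ideal. [OURS · L1 W4.5c] -/
theorem monomialElem_mem_irrelevant (d : Fin n →₀ ℕ) (hd : Finsupp.weight w d = 0) (hd0 : d ≠ 0) :
    monomialElem k n p w d hd ∈ irrelevant k n p w := by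
  classical
  rw [mem_irrelevant_iff, coe_monomialElem, constantCoeff_monomial, if_neg hd0]

/-- A cone element whose underlying polynomial is a monomial `x^d`, `d ≠ 0`, lies in the irrelevant
ideal. [OURS · L1 W4.5c] -/
theorem mem_irrelevant_of_coe_eq_monomial (f : cone k n p w) (d : Fin n →₀ ℕ) (hd0 : d ≠ 0)
    (hf : (f : MvPolynomial (Fin n) k) = monomial d 1) : f ∈ irrelevant k n p w := by
  classical
  rw [mem_irrelevant_iff, hf, constantCoeff_monomial, if_neg hd0]

/-- A power `x_l^e` with `p ∣ e` lies in the cone. [OURS · L1 W4.5c] -/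
theorem X_pow_mem_cone_of_dvd (l : Fin n) {e : ℕ} (he : p ∣ e) :
    (X l ^ e : MvPolynomial (Fin n) k) ∈ cone k n p w := by
  rw [mem_cone_iff]
  have h := (isWeightedHomogeneous_X k w l).pow e
  have hz : e • w l = 0 := by
    obtain ⟨c, rfl⟩ := he
    rw [nsmul_eq_mul, Nat.cast_mul, ZMod.natCast_self, zero_mul, zero_mul]
  simpa [hz] using h

/-- Decomposition of a cone element into its weight-`0` monomials: for any `μ` agreeing with
`monomialElem` on weight-`0` exponents, `f = Σ_d coeff_d(f) • μ d`. [OURS · L1 W4.5c] -/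
theorem eq_sum_coeff_smul (f : cone k n p w) (μ : (Fin n →₀ ℕ) → cone k n p w)
    (hμ : ∀ (d : Fin n →₀ ℕ) (hd : Finsupp.weight w d = 0), μ d = monomialElem k n p w d hd) :
    f = ∑ d ∈ (f : MvPolynomial (Fin n) k).support, coeff d (f : MvPolynomial (Fin n) k) • μ d := by
  obtain ⟨g, hg⟩ := f
  apply Subtype.ext
  change g = ((∑ d ∈ g.support, coeff d g • μ d : cone k n p w) : MvPolynomial (Fin n) k)
  rw [AddSubmonoidClass.coe_finsetSum]
  conv_lhs => rw [g.as_sum]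
  refine Finset.sum_congr rfl fun d hd => ?_
  rw [Subalgebra.coe_smul, hμ d (hg (MvPolynomial.mem_support_iff.mp hd)), coe_monomialElem,
    smul_monomial, smul_eq_mul, mul_one]

/-- **Radical criterion.** An ideal `J` of the cone contained in the irrelevant ideal and containing,
for every variable `x_l`, a power `x_l ^ e l` with `p ∣ e l`, has radical equal to the
irrelevant ideal: for a weight-`0` monomial `x^d` with `d_l ≥ 1`,
`(x^d)^{e l} = (x_l^{e l})^{d_l} · x^{e l · (d − d_l 𝐞_l)} ∈ J`. [OURS · L1 W4.5c] -/
theorem radical_eq_irrelevant_of_pow_mem (J : Ideal (cone k n p w)) (hJ : J ≤ irrelevant k n p w)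
    (e : Fin n → ℕ) (hpe : ∀ l, p ∣ e l)
    (hmem : ∀ l, (⟨X l ^ e l, X_pow_mem_cone_of_dvd k n p w l (hpe l)⟩ : cone k n p w) ∈ J) :
    J.radical = irrelevant k n p w := by
  classical
  apply le_antisymm
  · rw [← radical_irrelevant]
    exact Ideal.radical_mono hJ
  · intro f hf
    -- each monomial of `f` is a non-constant weight-`0` monomial, and a power of it lies in `J`
    have hmono : ∀ (d : Fin n →₀ ℕ) (hd : Finsupp.weight w d = 0), d ≠ 0 →
        monomialElem k n p w d hd ∈ J.radical := by
      intro d hd hd0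
      obtain ⟨l, hl⟩ : ∃ l, d l ≠ 0 := by
        by_contra h
        push Not at h
        exact hd0 (Finsupp.ext fun i => by simpa using h i)
      -- the complementary factor `x^{e l · (d - d_l e_l)}`
      let d' : Fin n →₀ ℕ := e l • (d - Finsupp.single l (d l))
      have hd' : Finsupp.weight w d' = 0 := by
        obtain ⟨c, hc⟩ := hpe l
        rw [map_nsmul, hc, mul_smul, nsmul_eq_mul (p : ℕ), ZMod.natCast_self, zero_mul]
      refine ⟨e l, ?_⟩
      have hexp : e l • d = Finsupp.single l (e l * d l) + d' := by
        ext i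
        simp only [d', Finsupp.smul_apply, smul_eq_mul, Finsupp.add_apply, Finsupp.single_apply,
          Finsupp.tsub_apply]
        by_cases hi : l = i
        · subst hi; simp
        · rw [if_neg hi, if_neg hi]; simp
      have key : monomialElem k n p w d hd ^ e l =
          (⟨X l ^ e l, X_pow_mem_cone_of_dvd k n p w l (hpe l)⟩ : cone k n p w) ^ d l *
            monomialElem k n p w d' hd' := by
        apply Subtype.ext
        simp only [SubmonoidClass.coe_pow, Subalgebra.coe_mul, coe_monomialElem]
        rw [monomial_pow, one_pow, ← pow_mul, X_pow_eq_monomial, monomial_mul, one_mul, hexp]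
      rw [key]
      exact Ideal.mul_mem_right _ _ (Ideal.pow_mem_of_mem J (hmem l) _ (Nat.pos_of_ne_zero hl))
    -- decompose `f`
    have hf0 : constantCoeff (f : MvPolynomial (Fin n) k) = 0 := (mem_irrelevant_iff k n p w f).mp hf
    let μ : (Fin n →₀ ℕ) → cone k n p w := fun d =>
      if hd : Finsupp.weight w d = 0 then monomialElem k n p w d hd else 0
    have hμ : ∀ (d : Fin n →₀ ℕ) (hd : Finsupp.weight w d = 0), μ d = monomialElem k n p w d hd :=
      fun d hd => by simp [μ, hd]
    rw [eq_sum_coeff_smul k n p w f μ hμ]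
    refine Ideal.sum_mem _ fun d hd => ?_
    rw [Algebra.smul_def]
    have hwd : Finsupp.weight w d = 0 := f.2 (Finsupp.mem_support_iff.mp hd)
    rw [hμ d hwd]
    refine Ideal.mul_mem_left _ _ (hmono d hwd fun h0 => ?_)
    rw [h0, MvPolynomial.mem_support_iff] at hd
    exact hd (by simpa [constantCoeff_eq] using hf0)

/-- The Veronese vertex ideal is contained in the irrelevant ideal (its generators are monomials of
degree `p > 0`). [OURS · L1 W4.5c] -/
theorem vertexIdeal_le_irrelevant (hp : 0 < p) : vertexIdeal k n p w ≤ irrelevant k n p w := by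
  classical
  unfold vertexIdeal
  rw [Ideal.span_le, range_vertexFamily]
  rintro _ ⟨v, rfl⟩
  refine mem_irrelevant_of_coe_eq_monomial k n p w _ (vertexExp n p w v) ?_ (coe_vertexGen k n p w v)
  obtain ⟨z, -, hz⟩ := exists_pos_of_vIdx n p w hp v
  intro h
  have := congrArg (fun f => f z) h
  rw [vertexExp_apply, Finsupp.zero_apply] at this
  omega

/-- **`b = 0` addendum.** If every variable has weight `1` (no passengers, no weight `−1`), the
Veronese vertex ideal has radical the irrelevant ideal: `x_l^p` is a vertex generator for every `l`.
[OURS · L1 W4.5c] -/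
theorem vertexIdeal_radical (hp : 0 < p) (hw : ∀ i, w i = 1) :
    (vertexIdeal k n p w).radical = irrelevant k n p w := by
  classical
  refine radical_eq_irrelevant_of_pow_mem k n p w _ (vertexIdeal_le_irrelevant k n p w hp)
    (fun _ => p) (fun _ => dvd_rfl) fun l => ?_
  have h : (⟨X l ^ p, X_pow_mem_cone_of_dvd k n p w l dvd_rfl⟩ : cone k n p w) =
      vertexGen k n p w (pureIdx n p w l (hw l)) :=
    Subtype.ext (by rw [coe_vertexGen_pureIdx])
  rw [h]
  unfold vertexIdeal
  rw [← vertexFamily_equivFin]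
  exact Ideal.subset_span ⟨_, rfl⟩

end Summit.ResolutionOfSingularities.ResolutionOfSingularities.Theorems.WildQuotientResolution.PthCone

end
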